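import Literature.NumberTheory.EllipticCurves.SelmerPInftyRestrictionJZero
import Literature.NumberTheory.EllipticCurves.KatoTwistedFinitenessKummerDescentProofs
import HarnessLib

/-!
# The action of `Gal(K/ℚ)` on `H¹(K, E_K)` and `H¹(K, E_K[p^∞])` does not depend on the lift

For `E = W/ℚ`, a field `K ⊇ ℚ` of characteristic `0`, `σ ∈ Aut(K/ℚ)` and two lifts `τ, τ'` of `σ`
to ring automorphisms of `K̄`, the induced maps on `H¹(K, E_K)` (the tree's
`IsLiftOfAut.conjH1Points`) COINCIDE (`IsLiftOfAut.conjH1Points_eq`; the points-level companion of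
the tree's `IsLiftOfAut.conjH1_eq` on `H¹(K, E[n])` and `IsLiftOfAut.conjH1Primary_eq` on
`H¹(K, E[p^∞])`): `γ = τ'⁻¹ τ ∈ Γ_K` (`IsLiftOfAut.divGal`), the compatible pair of `τ` is the pair
of `τ'` precomposed with the INNER pair of `γ` (`IsLiftOfAut.conjGalCMH_eq_conj_comp`,
`IsLiftOfAut.pointsMap_eq_comp`), and inner pairs act trivially on `H¹` (`map_one_eq_of_conj_comp`;
Serre, *Corps locaux*, VII.§5 Prop. 3). So the `Gal(K/ℚ)`-action on `H¹(K, E_K)` and `Ш(E_K/K)` is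
well defined.

Consequence: the exact-descent statements of `ShaRestrictionJZeroInvariants` and
`SelmerPInftyRestrictionJZero` (stated for the chosen lift `liftAut σ`) hold for EVERY lift `τ` of
`σ` (`JZero.range_resBaseChange_eq_of_isLiftOfAut`, `JZero.range_shaRestriction_eq_of_isLiftOfAut`,
`JZero.existsUnique_shaRestriction_eq_of_isLiftOfAut`, `JZero.range_resPrimary_eq_of_isLiftOfAut`,
`JZero.existsUnique_resPrimary_eq_of_mem_selmerGroupPInfty_of_isLiftOfAut`). Everything here is
proved; no new definitions.

## References

* J.-P. Serre, *Local Fields* (1979), VII.§5, Prop. 3. [SerreLocalFields1979]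
* J.-P. Serre, *Galois Cohomology* (1997), I.§2.4–2.5. [SerreGaloisCohomology1997]
* B. H. Gross, Kolyvagin's work on modular elliptic curves (1991), §5 (5.1). [GrossLMS1991]
-/

noncomputable section

open scoped Classical

universe u

namespace Literature.NumberTheory.EllipticCurves

open GaloisRepresentations WeierstrassCurve

/-! ## Lift independence -/

section LiftIndependence

variable {K : Type u} [Field K] [CharZero K] (W : WeierstrassCurve ℚ)
variable {σ : K ≃ₐ[ℚ] K} {τ₁ τ₂ : AlgebraicClosure K ≃+* AlgebraicClosure K}

/-- Changing the lift by `γ = τ₂⁻¹ τ₁ ∈ Γ_K` (`IsLiftOfAut.divGal`) twists the coefficient side of the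
pair on all of `E_K(K̄)`: `τ₁ P = τ₂ (γ P)` (the points-level companion of the tree's
`IsLiftOfAut.torsionMap_eq_comp` / `primaryTorsionMap_eq_comp`). Serre, *Corps locaux*, VII.§5
(change of the lift = inner pair). [cite: SerreLocalFields1979, VII.§5 Prop. 3] -/
theorem IsLiftOfAut.pointsMap_eq_comp (hτ₁ : IsLiftOfAut σ τ₁) (hτ₂ : IsLiftOfAut σ τ₂) :
    hτ₁.pointsMap W = (hτ₂.pointsMap W).comp
      (DistribSMul.toAddMonoidHom (geomPoints (W.baseChange K)) (hτ₁.divGal hτ₂)) := by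
  apply AddMonoidHom.ext
  intro R
  change hτ₁.pointsMap W R = hτ₂.pointsMap W ((hτ₁.divGal hτ₂) • R)
  change ((W.baseChange K).baseChange (AlgebraicClosure K)).toAffine.Point at R
  rcases R with _ | ⟨x, y, h⟩
  · rfl
  · exact Affine.Point.some_eq_some_of_eq (τ₂.apply_symm_apply _).symm
      (τ₂.apply_symm_apply _).symm

/-- **The action of a lift on `H¹(K, E_K)` depends only on `σ`.** For two lifts `τ₁, τ₂` of
`σ ∈ Aut(K/ℚ)` to `K̄`: `(τ₁)_* = (τ₂)_*` on `H¹(K, E_K)` (`IsLiftOfAut.conjH1Points`). With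
`γ := τ₂⁻¹ τ₁ ∈ Γ_K`: `τ₁⁻¹ g τ₁ = γ⁻¹ (τ₂⁻¹ g τ₂) γ` (`conjGalCMH_eq_conj_comp`) and `τ₁ P = τ₂ (γ P)`
(`pointsMap_eq_comp`), so the pair of `τ₁` is the pair of `τ₂` precomposed with the inner pair of
`γ`, which acts as the identity on `H¹` (`map_one_eq_of_conj_comp`). (The summit tree's
`SylvesterTwoShaConjugation.conjH1Points_eq` / `pointsMap_eq_comp` are the same statements, proved
there for the BSD route; restated here so that `Literature/` can use them.) Serre, *Corps locaux*,
VII.§5, Prop. 3. [cite: SerreLocalFields1979, VII.§5 Prop. 3] [cite: GrossLMS1991, §5 (5.1)] -/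
theorem IsLiftOfAut.conjH1Points_eq (hτ₁ : IsLiftOfAut σ τ₁) (hτ₂ : IsLiftOfAut σ τ₂) :
    hτ₁.conjH1Points W = hτ₂.conjH1Points W := by
  unfold IsLiftOfAut.conjH1Points resH1Hom
  rw [map_one_eq_of_conj_comp hτ₂.conjGalCMH (hτ₂.pointsMap W) (hτ₂.pointsMap_smul W)
    (hτ₁.divGal hτ₂) (hτ₁.pointsMap_smul W) (hτ₁.conjGalCMH_eq_conj_comp hτ₂)
    (hτ₁.pointsMap_eq_comp W hτ₂)]

end LiftIndependence

/-! ## The exact descent for an arbitrary lift -/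

namespace JZero

variable (K : Type) [Field K] [NumberField K] (W : WeierstrassCurve ℚ) [W.IsElliptic]
variable {σ : K ≃ₐ[ℚ] K} {τ : AlgebraicClosure K ≃+* AlgebraicClosure K}

/-- **`res(H¹(ℚ, E)) = H¹(K, E_K)^{τ}` for every lift `τ` of `σ`** (`JZero.range_resBaseChange_eq` +
`IsLiftOfAut.conjH1Points_eq`). [cite: GrossLMS1991, §5 (5.1)]
[cite: SerreGaloisCohomology1997, I.§2.4 (Prop. 9 and Cor.) and I.§5.8] -/
theorem range_resBaseChange_eq_of_isLiftOfAut (hτ : IsLiftOfAut σ τ) (ha₁ : W.a₁ = 0)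
    (ha₂ : W.a₂ = 0) (ha₃ : W.a₃ = 0) (ha₄ : W.a₄ = 0) (h2 : Module.finrank ℚ K = 2) {ζ : K}
    (hζ : IsPrimitiveRoot ζ 3) (hσζ : σ ζ = ζ ^ 2) :
    ((resBaseChange W K).range : Set (W.baseChange K).galH1) = {s | hτ.conjH1Points W s = s} := by
  rw [hτ.conjH1Points_eq W (isLiftOfAut_liftAut σ)]
  exact range_resBaseChange_eq K W ha₁ ha₂ ha₃ ha₄ h2 hζ hσζ

/-- **`res(Ш(E/ℚ)) = Ш(E_K/K)^{τ}` for every lift `τ` of `σ`** (`JZero.range_shaRestriction_eq` +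
`IsLiftOfAut.conjH1Points_eq`). [cite: GrossLMS1991, §5 (5.1)]
[cite: SerreGaloisCohomology1997, I.§2.4 (Prop. 9 and Cor.) and I.§5.8] -/
theorem range_shaRestriction_eq_of_isLiftOfAut (hτ : IsLiftOfAut σ τ) (ha₁ : W.a₁ = 0)
    (ha₂ : W.a₂ = 0) (ha₃ : W.a₃ = 0) (ha₄ : W.a₄ = 0) (h2 : Module.finrank ℚ K = 2) {ζ : K}
    (hζ : IsPrimitiveRoot ζ 3) (hσζ : σ ζ = ζ ^ 2) :
    ((shaRestriction W K).range : Set (W.baseChange K).sha) =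
      {s : (W.baseChange K).sha | hτ.conjH1Points W (s : (W.baseChange K).galH1) = s} := by
  rw [hτ.conjH1Points_eq W (isLiftOfAut_liftAut σ)]
  exact range_shaRestriction_eq K W ha₁ ha₂ ha₃ ha₄ h2 hζ hσζ

/-- **`res : Ш(E/ℚ) ⥲ Ш(E_K/K)^{τ}` for every lift `τ` of `σ`**: unique preimages of invariant
elements (`JZero.existsUnique_shaRestriction_eq_of_conjH1Points_eq` + `IsLiftOfAut.conjH1Points_eq`).
[cite: GrossLMS1991, §5 (5.1)] [cite: SerreGaloisCohomology1997, I.§2.4 (Prop. 9 and Cor.) and I.§5.8] -/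
theorem existsUnique_shaRestriction_eq_of_isLiftOfAut (hτ : IsLiftOfAut σ τ) (ha₁ : W.a₁ = 0)
    (ha₂ : W.a₂ = 0) (ha₃ : W.a₃ = 0) (ha₄ : W.a₄ = 0) (h2 : Module.finrank ℚ K = 2) {ζ : K}
    (hζ : IsPrimitiveRoot ζ 3) (hσζ : σ ζ = ζ ^ 2) {s : (W.baseChange K).sha}
    (hs : hτ.conjH1Points W (s : (W.baseChange K).galH1) = s) :
    ∃! s₀ : W.sha, shaRestriction W K s₀ = s := by
  rw [hτ.conjH1Points_eq W (isLiftOfAut_liftAut σ)] at hs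
  exact existsUnique_shaRestriction_eq_of_conjH1Points_eq K W ha₁ ha₂ ha₃ ha₄ h2 hζ hσζ hs

/-- **`res(H¹(ℚ, E[p^∞])) = H¹(K, E_K[p^∞])^{τ}` for every lift `τ` of `σ`**
(`JZero.range_resPrimary_eq` + the tree's `IsLiftOfAut.conjH1Primary_eq`). [cite: GrossLMS1991, §5 (5.1)]
[cite: SerreGaloisCohomology1997, I.§2.4 (Prop. 9 and Cor.) and I.§5.8] -/
theorem range_resPrimary_eq_of_isLiftOfAut (p : ℕ) (hτ : IsLiftOfAut σ τ) (ha₁ : W.a₁ = 0)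
    (ha₂ : W.a₂ = 0) (ha₃ : W.a₃ = 0) (ha₄ : W.a₄ = 0) (h2 : Module.finrank ℚ K = 2) {ζ : K}
    (hζ : IsPrimitiveRoot ζ 3) (hσζ : σ ζ = ζ ^ 2) :
    ((resPrimary W K p).range : Set (galH1Primary (W.baseChange K) p)) =
      {s | hτ.conjH1Primary W p s = s} := by
  rw [hτ.conjH1Primary_eq W p (isLiftOfAut_liftAut σ)]
  exact range_resPrimary_eq K W p ha₁ ha₂ ha₃ ha₄ h2 hζ hσζ

/-- **`res : Sel_{p^∞}(E/ℚ) ⥲ Sel_{p^∞}(E_K/K)^{τ}` for every lift `τ` of `σ`**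
(`JZero.existsUnique_resPrimary_eq_of_mem_selmerGroupPInfty` + the tree's `IsLiftOfAut.conjH1Primary_eq`).
[cite: GrossLMS1991, §5 (5.1)] [cite: SerreGaloisCohomology1997, I.§2.4 (Prop. 9 and Cor.) and I.§5.8] -/
theorem existsUnique_resPrimary_eq_of_mem_selmerGroupPInfty_of_isLiftOfAut (p : ℕ)
    (hτ : IsLiftOfAut σ τ) (ha₁ : W.a₁ = 0) (ha₂ : W.a₂ = 0) (ha₃ : W.a₃ = 0) (ha₄ : W.a₄ = 0)
    (h2 : Module.finrank ℚ K = 2) {ζ : K} (hζ : IsPrimitiveRoot ζ 3) (hσζ : σ ζ = ζ ^ 2)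
    {s : galH1Primary (W.baseChange K) p} (hsel : s ∈ selmerGroupPInfty (W.baseChange K) p)
    (hs : hτ.conjH1Primary W p s = s) :
    ∃! η : galH1Primary W p, η ∈ selmerGroupPInfty W p ∧ resPrimary W K p η = s := by
  rw [hτ.conjH1Primary_eq W p (isLiftOfAut_liftAut σ)] at hs
  exact existsUnique_resPrimary_eq_of_mem_selmerGroupPInfty K W p ha₁ ha₂ ha₃ ha₄ h2 hζ hσζ hsel hs

end JZero

end Literature.NumberTheory.EllipticCurves
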